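import Literature.Computability.Complexity.BranchingProgramEntropy
import Summits.PneNP.PneNP.Theorems.SzkEntropyPeaThreeNotInPSocketRawDefs
import Summits.PneNP.PneNP.Theorems.SzkEntropyPeaThreeNotInPSocketAffineBit
import HarnessLib

/-!
# Route SzkEntropy, crux `PeaThreeNotInP` (stmt-PneNP-10776), line `SketchIdeator3`, socket rider:
# the parity program of a sparse polynomial is valid and computes the polynomial

The converse socket direction `PEA d ≤ₚ PEABP` sends a sparse polynomial map over `F₂` (a list of
output polynomials, each a list of monomials, a monomial a list of variables, value
`∑_μ ∏_{i ∈ μ} xᵢ`) to the list of its PARITY PROGRAMS `parityRaw`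
(`SzkEntropyPeaThreeNotInPSocketRawDefs.lean`: raw node lists `(tag, x, lo, hi)`, root the last
node, compiled by `RawBP.compile` of `BranchingProgramEntropy.lean`).  The two semantic stubs:

* `stub_parityRaw_valid` — the parity program of a polynomial with variables in `Fin n` is a
  VALID raw program over `n` variables (every decision node tests a variable `< n` and points to
  earlier nodes);
* `stub_parityRaw_fn` — it COMPUTES the polynomial: on `x ∈ F₂ⁿ`, read as the Boolean assignment
  `toInput x`, the compiled program outputs `[∑_{μ ∈ p} ∏_{i ∈ μ} xᵢ = 1]`.

Proof (all elementary, by induction): node-level unfolding of `RawBP.toBDD` (the value at a sink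
is its label, at a decision node it follows the tested variable — read off the raw entry), PREFIX
STABILITY (appending nodes does not change the values of the old nodes), the CHAIN LEMMA (the
entry of `chainRaw μ` evaluates to the "flip" continuation iff all variables of `μ` are `1`, to
the "keep" continuation otherwise), the FOLD INVARIANT of `parityStep` (after folding the
monomials `q`, the parity-`b` continuation computes `[c + #{μ ∈ q : μ(x) = 1} + b odd]`, `c` the
number of empty monomials), and the count `∑_μ ∏ xᵢ = #{μ : μ(x) = 1} (mod 2)`.
[I. Wegener, *Branching programs and binary decision diagrams*, SIAM 2000, §1.1 (parity /
linear functions have width-2 programs); folklore]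
-/

namespace Summit.PneNP.PneNP.Cruxes.PeaThreeNotInP.SocketBP

set_option linter.dupNamespace false -- `Summit.PneNP.PneNP.…`: summit = sub-problem name (D-0017)

open Literature.Computability.Complexity

namespace SocketParity

open SocketAffineBit (eval_sink eval_branch)

/-! ### Node-level unfolding of `RawBP.toBDD` -/

/-- **Prefix stability**: appending nodes to a valid raw program does not change the values of
the old nodes (they only point backwards). [folklore] -/
theorem eval_prefix {n : ℕ} {L B C : RawBP} (hL : L = B ++ C) (hL' : RawBP.Valid n L)
    (hB : RawBP.Valid n B) (z : Fin n → Bool) (i : ℕ) (hi : i < B.length) (hi' : i < L.length) :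
    (RawBP.toBDD n L hL').eval z ⟨i, hi'⟩ = (RawBP.toBDD n B hB).eval z ⟨i, hi⟩ := by
  subst hL
  suffices H : ∀ (N i : ℕ) (hi : i < B.length) (hi' : i < (B ++ C).length), i < N →
      (RawBP.toBDD n (B ++ C) hL').eval z ⟨i, hi'⟩ = (RawBP.toBDD n B hB).eval z ⟨i, hi⟩ from
    H (i + 1) i hi hi' (Nat.lt_succ_self i)
  intro N
  induction N with
  | zero => exact fun i _ _ h0 => absurd h0 (Nat.not_lt_zero i)
  | succ N ih =>
    intro i hi hi' hiN
    have he : (B ++ C)[i] = B[i] := List.getElem_append_left hi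
    rcases hnd : B[i] with ⟨t, x, lo, hh⟩
    rw [hnd] at he
    by_cases ht : 2 ≤ t
    · have hok : RawBP.nodeOK n i (t, x, lo, hh) = true := by
        simpa only [Fin.getElem_fin, hnd] using hB.2 ⟨i, hi⟩
      obtain ⟨hx, hlo, hhh⟩ : x < n ∧ lo < i ∧ hh < i := RawBP.nodeOK_branch hok ht
      rw [eval_branch hL' z hi' he ht hx (by rw [List.length_append]; omega)
          (by rw [List.length_append]; omega),
        eval_branch hB z hi hnd ht hx (by omega) (by omega),
        ih lo (by omega) (by rw [List.length_append]; omega) (by omega),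
        ih hh (by omega) (by rw [List.length_append]; omega) (by omega)]
    · rw [eval_sink hL' z hi' he (by omega), eval_sink hB z hi hnd (by omega)]

/-- A node whose data are in range is well-formed. [folklore] -/
theorem nodeOK_of {n i t x lo hi : ℕ} (hx : x < n) (hlo : lo < i) (hhi : hi < i) :
    RawBP.nodeOK n i (t, x, lo, hi) = true := by
  simp [RawBP.nodeOK, hx, hlo, hhi]

/-- Appending one well-formed node keeps a raw program valid. [folklore] -/
theorem valid_snoc {n : ℕ} {B : RawBP} (hB : RawBP.Valid n B) (nd : RawBPNode)
    (hnd : RawBP.nodeOK n B.length nd = true) : RawBP.Valid n (B ++ [nd]) := by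
  refine ⟨by simp, fun ⟨i, hi⟩ => ?_⟩
  simp only [Fin.getElem_fin]
  rcases Nat.lt_or_ge i B.length with h | h
  · rw [List.getElem_append_left h]
    simpa only [Fin.getElem_fin] using hB.2 ⟨i, h⟩
  · have hi2 : i = B.length := by rw [List.length_append, List.length_singleton] at hi; omega
    subst hi2
    rw [List.getElem_concat_length rfl]
    exact hnd

/-! ### The chain of one monomial -/

/-- The chain has one node per variable. [folklore] -/
theorem length_chainRaw (μ : List ℕ) (start kb kf : ℕ) :
    (chainRaw μ start kb kf).length = μ.length := by
  simp [chainRaw]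

/-- The chain of `a :: μ` is the chain of `μ` followed by the test of `a` (its entry), whose
`1`-successor is the entry of the chain of `μ` (or `kf` if `μ` is empty). [folklore] -/
theorem chainRaw_cons (a : ℕ) (μ : List ℕ) (start kb kf : ℕ) : chainRaw (a :: μ) start kb kf =
    chainRaw μ start kb kf ++ [(2, a, kb, if μ.length = 0 then kf else start + μ.length - 1)] := by
  simp [chainRaw, List.reverse_cons, List.zipIdx_append]

/-- Appending the chain of a monomial with variables `< n` and continuations inside the program
keeps it valid. [folklore] -/
theorem valid_chainRaw {n : ℕ} {B : RawBP} (hB : RawBP.Valid n B) {kb kf : ℕ}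
    (hkb : kb < B.length) (hkf : kf < B.length) :
    ∀ (μ : List ℕ), (∀ v ∈ μ, v < n) → RawBP.Valid n (B ++ chainRaw μ B.length kb kf)
  | [], _ => by simpa [chainRaw] using hB
  | a :: μ, hμ => by
    rw [chainRaw_cons, ← List.append_assoc]
    refine valid_snoc (valid_chainRaw hB hkb hkf μ fun v hv => hμ v (List.mem_cons_of_mem a hv))
      _ (nodeOK_of (hμ a List.mem_cons_self) ?_ ?_)
    · rw [List.length_append, length_chainRaw]; omega
    · rw [List.length_append, length_chainRaw]; split <;> omega

/-- **The chain lemma**: the entry (last node) of the chain of a non-empty monomial `μ` appended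
to a valid program evaluates to the "flip" continuation `kf` if all variables of `μ` are `1`,
and to the "keep" continuation `kb` otherwise. [Wegener 2000, §1.1] [folklore] -/
theorem eval_chainRaw {n : ℕ} (z : Fin n → Bool) (zN : ℕ → Bool)
    (hz : ∀ (v : ℕ) (hv : v < n), zN v = z ⟨v, hv⟩) {B : RawBP} (hB : RawBP.Valid n B)
    {kb kf : ℕ} (hkb : kb < B.length) (hkf : kf < B.length) :
    ∀ (μ : List ℕ), μ ≠ [] → (∀ v ∈ μ, v < n) →
    ∀ (L : RawBP), L = B ++ chainRaw μ B.length kb kf → ∀ (hL' : RawBP.Valid n L) (i : ℕ),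
      i = B.length + μ.length - 1 → ∀ (hi : i < L.length),
      (RawBP.toBDD n L hL').eval z ⟨i, hi⟩ =
        if μ.all zN then (RawBP.toBDD n B hB).eval z ⟨kf, hkf⟩
        else (RawBP.toBDD n B hB).eval z ⟨kb, hkb⟩
  | [], hne, _, _, _, _, _, _, _ => absurd rfl hne
  | a :: μ, _, hμn, L, hL, hL', i, hieq, hi => by
    have ha : a < n := hμn a List.mem_cons_self
    have hμn' : ∀ v ∈ μ, v < n := fun v hv => hμn v (List.mem_cons_of_mem a hv)
    have hB₁ : RawBP.Valid n (B ++ chainRaw μ B.length kb kf) := valid_chainRaw hB hkb hkf μ hμn'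
    have hlen : (B ++ chainRaw μ B.length kb kf).length = B.length + μ.length := by
      rw [List.length_append, length_chainRaw]
    have hi2 : i = B.length + μ.length := by rw [hieq, List.length_cons]; omega
    have hL2 : L = (B ++ chainRaw μ B.length kb kf) ++
        [(2, a, kb, if μ.length = 0 then kf else B.length + μ.length - 1)] := by
      rw [hL, chainRaw_cons, List.append_assoc]
    have hLlen : L.length = B.length + μ.length + 1 := by
      rw [hL2, List.length_append, hlen, List.length_singleton]
    by_cases hμ : μ = []
    · have hμ0 : μ.length = 0 := List.length_eq_zero_iff.mpr hμ
      have he : L[i] = (2, a, kb, kf) := by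
        rw [List.getElem_of_eq hL2 hi, List.getElem_concat_length (by omega), if_pos hμ0]
      rw [eval_branch hL' z hi he (le_refl 2) ha (by omega) (by omega),
        eval_prefix hL hL' hB z kf hkf, eval_prefix hL hL' hB z kb hkb]
      subst hμ
      simp [hz a ha]
    · have hd : 0 < μ.length := List.length_pos_iff.mpr hμ
      have he : L[i] = (2, a, kb, B.length + μ.length - 1) := by
        rw [List.getElem_of_eq hL2 hi, List.getElem_concat_length (by omega), if_neg (by omega)]
      rw [eval_branch hL' z hi he (le_refl 2) ha (by omega) (by omega),
        eval_prefix hL2 hL' hB₁ z (B.length + μ.length - 1) (by omega),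
        eval_chainRaw z zN hz hB hkb hkf μ hμ hμn' _ rfl hB₁ _ rfl,
        eval_prefix hL hL' hB z kb hkb]
      simp only [List.all_cons, hz a ha]
      cases z ⟨a, ha⟩ <;> simp

/-! ### The fold invariant of `parityStep` -/

/-- After folding the monomials `q` (all non-empty, variables `< n`) the program is valid, the
parity-`0` continuation is its last node and the parity-`1` continuation is a node. [folklore] -/
theorem fold_valid {n : ℕ} (odd : Bool) :
    ∀ (q : List (List ℕ)), (∀ μ ∈ q, μ ≠ [] ∧ ∀ v ∈ μ, v < n) →
    ∀ (st : List (ℕ × ℕ × ℕ × ℕ) × ℕ × ℕ), st = q.reverse.foldl parityStep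
        ([(if odd then 0 else 1, 0, 0, 0), (if odd then 1 else 0, 0, 0, 0)], 1, 0) →
      RawBP.Valid n st.1 ∧ st.2.1 + 1 = st.1.length ∧ st.2.2 < st.1.length
  | [], _, st, hst => by
    subst hst
    refine ⟨⟨by simp, fun ⟨i, hi⟩ => ?_⟩, by simp, by simp⟩
    have hi2 : i < 2 := by simpa using hi
    simp only [List.reverse_nil, List.foldl_nil, Fin.getElem_fin]
    interval_cases i <;> cases odd <;> simp [RawBP.nodeOK]
  | μ :: q, hq, st, hst => by
    obtain ⟨hμ, hμn⟩ := hq μ List.mem_cons_self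
    have hq' : ∀ ν ∈ q, ν ≠ [] ∧ ∀ v ∈ ν, v < n := fun ν hν => hq ν (List.mem_cons_of_mem μ hν)
    have hd : 0 < μ.length := List.length_pos_iff.mpr hμ
    simp only [List.reverse_cons, List.foldl_append, List.foldl_cons, List.foldl_nil] at hst
    rcases hfold : q.reverse.foldl parityStep
        ([(if odd then 0 else 1, 0, 0, 0), (if odd then 1 else 0, 0, 0, 0)], 1, 0) with ⟨L₀, a0, a1⟩
    rw [hfold] at hst
    obtain ⟨hV₀, ha0, ha1⟩ := fold_valid odd q hq' _ hfold.symm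
    simp only at hV₀ ha0 ha1
    subst hst; simp only [parityStep]
    have hV₁ : RawBP.Valid n (L₀ ++ chainRaw μ L₀.length a1 a0) :=
      valid_chainRaw hV₀ ha1 (by omega) μ hμn
    have hlen : (L₀ ++ chainRaw μ L₀.length a1 a0).length = L₀.length + μ.length := by
      rw [List.length_append, length_chainRaw]
    have hV₂ := valid_chainRaw hV₁ (kb := a0) (kf := a1) (by omega) (by omega) μ hμn
    rw [hlen] at hV₂
    refine ⟨hV₂, ?_, ?_⟩ <;> simp only [List.length_append, length_chainRaw] <;> omega

/-- **The fold invariant**: after folding the monomials `q` from the sinks labelled by the parity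
of `c`, the parity-`0` continuation computes `[c + #{μ ∈ q : all variables of μ are 1} odd]` and
the parity-`1` continuation the negation. [Wegener 2000, §1.1] [folklore] -/
theorem fold_eval {n : ℕ} (c : ℕ) (z : Fin n → Bool) (zN : ℕ → Bool)
    (hz : ∀ (v : ℕ) (hv : v < n), zN v = z ⟨v, hv⟩) :
    ∀ (q : List (List ℕ)), (∀ μ ∈ q, μ ≠ [] ∧ ∀ v ∈ μ, v < n) →
    ∀ (st : List (ℕ × ℕ × ℕ × ℕ) × ℕ × ℕ), st = q.reverse.foldl parityStep
        ([(if decide (c % 2 = 1) then 0 else 1, 0, 0, 0),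
          (if decide (c % 2 = 1) then 1 else 0, 0, 0, 0)], 1, 0) →
    ∀ (h : RawBP.Valid n st.1) (h0 : st.2.1 < st.1.length) (h1 : st.2.2 < st.1.length),
      (RawBP.toBDD n st.1 h).eval z ⟨st.2.1, h0⟩ =
          decide ((c + (q.filter fun μ => μ.all zN).length) % 2 = 1) ∧
        (RawBP.toBDD n st.1 h).eval z ⟨st.2.2, h1⟩ =
          decide ((c + (q.filter fun μ => μ.all zN).length + 1) % 2 = 1)
  | [], _, st, hst, h, h0, h1 => by
    subst hst
    dsimp only [List.reverse_nil, List.foldl_nil, List.filter_nil, List.length_nil]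
    refine ⟨(eval_sink h z h0 (t := if decide (c % 2 = 1) then 1 else 0) (x := 0) (lo := 0)
        (hi' := 0) rfl (by split <;> omega)).trans ?_,
      (eval_sink h z h1 (t := if decide (c % 2 = 1) then 0 else 1) (x := 0) (lo := 0)
        (hi' := 0) rfl (by split <;> omega)).trans ?_⟩
    · by_cases hc : c % 2 = 1 <;> simp [hc]
    · by_cases hc : c % 2 = 1 <;> simp [hc] <;> omega
  | μ :: q, hq, st, hst, h, h0, h1 => by
    obtain ⟨hμ, hμn⟩ := hq μ List.mem_cons_self
    have hq' : ∀ ν ∈ q, ν ≠ [] ∧ ∀ v ∈ ν, v < n := fun ν hν => hq ν (List.mem_cons_of_mem μ hν)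
    have hd : 0 < μ.length := List.length_pos_iff.mpr hμ
    simp only [List.reverse_cons, List.foldl_append, List.foldl_cons, List.foldl_nil] at hst
    rcases hfold : q.reverse.foldl parityStep
        ([(if decide (c % 2 = 1) then 0 else 1, 0, 0, 0),
          (if decide (c % 2 = 1) then 1 else 0, 0, 0, 0)], 1, 0) with ⟨L₀, a0, a1⟩
    rw [hfold] at hst
    obtain ⟨hV₀, ha0, ha1⟩ := fold_valid (decide (c % 2 = 1)) q hq' _ hfold.symm
    simp only at hV₀ ha0 ha1
    obtain ⟨IH0, IH1⟩ := fold_eval c z zN hz q hq' _ hfold.symm hV₀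
      (show a0 < L₀.length by omega) ha1
    subst hst
    dsimp only [parityStep]
    set B₁ := L₀ ++ chainRaw μ L₀.length a1 a0 with hB₁
    have hB₁len : B₁.length = L₀.length + μ.length := by
      rw [hB₁, List.length_append, length_chainRaw]
    have hVB₁ : RawBP.Valid n B₁ := valid_chainRaw hV₀ ha1 (by omega) μ hμn
    have ha0' : a0 < B₁.length := by omega
    have ha1' : a1 < B₁.length := by omega
    have hL : B₁ ++ chainRaw μ (L₀.length + μ.length) a0 a1 = B₁ ++ chainRaw μ B₁.length a0 a1 := by
      rw [hB₁len]
    constructor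
    · refine (eval_chainRaw z zN hz hVB₁ ha0' ha1' μ hμ hμn _ hL h
        (L₀.length + 2 * μ.length - 1) (by omega) h0).trans ?_
      rw [eval_prefix hB₁ hVB₁ hV₀ z a1 ha1 ha1', eval_prefix hB₁ hVB₁ hV₀ z a0 (by omega) ha0',
        IH0, IH1, List.filter_cons]
      split_ifs
      · simp only [List.length_cons, decide_eq_decide]; omega
      · rfl
    · refine (eval_prefix (L := B₁ ++ chainRaw μ (L₀.length + μ.length) a0 a1) (B := B₁)
        (C := chainRaw μ (L₀.length + μ.length) a0 a1) rfl h hVB₁ z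
        (L₀.length + μ.length - 1) (by omega) h1).trans ?_
      refine (eval_chainRaw z zN hz hV₀ ha1 (show a0 < L₀.length by omega) μ hμ hμn B₁ hB₁ hVB₁
        (L₀.length + μ.length - 1) rfl _).trans ?_
      rw [IH0, IH1, List.filter_cons]
      split_ifs
      · simp only [List.length_cons, decide_eq_decide]; omega
      · rfl

/-! ### Counting: the value of a sparse polynomial over `F₂` -/

/-- A monomial over `F₂` is `1` if all its variables are `1`, and `0` otherwise. [folklore] -/
theorem prod_eq_ite {n : ℕ} (x : Fin n → ZMod 2) (zN : ℕ → Bool)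
    (hz : ∀ i : Fin n, zN i.val = decide (x i = 1)) :
    ∀ μ : List (Fin n), (μ.map x).prod = if (μ.map Fin.val).all zN then 1 else 0
  | [] => by simp
  | i :: μ => by
    rw [List.map_cons, List.prod_cons, prod_eq_ite x zN hz μ, List.map_cons, List.all_cons, hz i]
    have h01 : (0 : ZMod 2) ≠ 1 := by decide
    rcases (by decide : ∀ a : ZMod 2, a = 0 ∨ a = 1) (x i) with h | h <;> simp [h, h01]

/-- The value of a sparse polynomial over `F₂` is the number of its monomials all of whose
variables are `1`, mod `2`. [folklore] -/
theorem sum_eq_count {n : ℕ} (x : Fin n → ZMod 2) (zN : ℕ → Bool)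
    (hz : ∀ i : Fin n, zN i.val = decide (x i = 1)) :
    ∀ p : List (List (Fin n)), (p.map fun μ => (μ.map x).prod).sum =
      ((((p.map (List.map Fin.val)).filter fun μ => μ.all zN).length : ℕ) : ZMod 2)
  | [] => by simp
  | μ :: p => by
    rw [List.map_cons, List.sum_cons, sum_eq_count x zN hz p, prod_eq_ite x zN hz μ, List.map_cons,
      List.filter_cons]
    split_ifs
    · rw [List.length_cons]; push_cast; ring
    · rw [zero_add]

/-- Splitting a count of monomials into the empty ones (all counted) and the non-empty ones.
[folklore] -/
theorem count_split (P : List ℕ → Bool) (hP : P [] = true) :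
    ∀ l : List (List ℕ), (l.filter P).length =
      (l.filter fun μ => μ.isEmpty).length + ((l.filter fun μ => !μ.isEmpty).filter P).length
  | [] => by simp
  | [] :: l => by
    have ih := count_split P hP l
    rw [List.filter_cons, List.filter_cons, List.filter_cons, if_pos hP, if_pos List.isEmpty_nil,
      if_neg (show ¬ ((!([] : List ℕ).isEmpty) = true) by simp)]
    simp only [List.length_cons]
    omega
  | (a :: μ) :: l => by
    have ih := count_split P hP l
    rw [List.filter_cons, List.filter_cons, List.filter_cons,
      if_neg (show ¬ ((a :: μ).isEmpty = true) by simp),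
      if_pos (show (!(a :: μ).isEmpty) = true by simp), List.filter_cons]
    split_ifs
    · simp only [List.length_cons]; omega
    · omega

/-- The non-empty monomials of a polynomial with variables in `Fin n`, as raw lists, are
non-empty with variables `< n`. [folklore] -/
theorem filter_hyp {n : ℕ} (p : List (List (Fin n))) :
    ∀ μ ∈ (p.map (List.map Fin.val)).filter (fun μ => !μ.isEmpty), μ ≠ [] ∧ ∀ v ∈ μ, v < n := by
  intro μ hμ
  rw [List.mem_filter, List.mem_map] at hμ
  obtain ⟨⟨ν, -, rfl⟩, hne⟩ := hμ
  refine ⟨fun h0 => by simp [h0] at hne, fun v hv => ?_⟩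
  rw [List.mem_map] at hv
  obtain ⟨i, -, rfl⟩ := hv
  exact i.isLt

end SocketParity

/-! ### The two stubs -/

/-- **The parity program is valid**: the parity program of a sparse polynomial with variables in
`Fin n` is a valid raw branching program over `n` variables (every decision node tests a
variable `< n` and points to earlier nodes; it is non-empty). [Wegener 2000, §1.1] [folklore] -/
theorem stub_parityRaw_valid {n : ℕ} (p : List (List (Fin n))) :
    RawBP.Valid n (parityRaw (p.map (List.map Fin.val))) := by
  dsimp only [parityRaw]
  exact (SocketParity.fold_valid _ _ (SocketParity.filter_hyp p) _ rfl).1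

/-- **The parity program computes the polynomial**: on `x ∈ F₂ⁿ` (read as the Boolean assignment
`toInput x`) the compiled parity program of `p` outputs `[∑_{μ ∈ p} ∏_{i ∈ μ} xᵢ = 1]`.
[Wegener 2000, §1.1 (parity / linear functions have width-2 branching programs)] [folklore] -/
theorem stub_parityRaw_fn {n : ℕ} (p : List (List (Fin n))) (x : Fin n → ZMod 2) :
    (RawBP.compile n (parityRaw (p.map (List.map Fin.val)))).2.fn
        (Literature.Computability.Cryptography.toInput x) =
      decide ((p.map fun μ => (μ.map x).prod).sum = 1) := by
  set pN := p.map (List.map Fin.val) with hpN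
  set z := Literature.Computability.Cryptography.toInput x with hzdef
  have hv : RawBP.Valid n (parityRaw pN) := stub_parityRaw_valid p
  rw [RawBP.compile_of_valid hv]
  set c := (pN.filter fun μ => μ.isEmpty).length with hc
  set q := pN.filter (fun μ => !μ.isEmpty) with hq
  set st := q.reverse.foldl parityStep
      ([(if decide (c % 2 = 1) then 0 else 1, 0, 0, 0),
        (if decide (c % 2 = 1) then 1 else 0, 0, 0, 0)], 1, 0) with hst
  have hqh : ∀ μ ∈ q, μ ≠ [] ∧ ∀ v ∈ μ, v < n := SocketParity.filter_hyp p
  obtain ⟨-, hk0, hk1⟩ := SocketParity.fold_valid (decide (c % 2 = 1)) q hqh st hst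
  have hpr : parityRaw pN = st.1 := rfl
  have hzN : ∀ (v : ℕ) (hv : v < n),
      (fun v => if hv : v < n then z ⟨v, hv⟩ else false) v = z ⟨v, hv⟩ :=
    fun v hv => dif_pos hv
  obtain ⟨he0, -⟩ := SocketParity.fold_eval c z _ hzN q hqh st hst hv
    (show st.2.1 < st.1.length by omega) hk1
  have hroot : (RawBP.toBDD n (parityRaw pN) hv).root =
      ⟨st.2.1, (show st.2.1 < st.1.length by omega)⟩ :=
    Fin.ext (show (parityRaw pN).length - 1 = st.2.1 by rw [hpr]; omega)
  change (RawBP.toBDD n (parityRaw pN) hv).eval z (RawBP.toBDD n (parityRaw pN) hv).root = _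
  rw [hroot]
  refine he0.trans ?_
  have hz' : ∀ i : Fin n, (fun v => if hv : v < n then z ⟨v, hv⟩ else false) i.val =
      decide (x i = 1) := fun i => by
    show (if hv : (i : ℕ) < n then z ⟨i, hv⟩ else false) = _
    rw [dif_pos i.isLt]
    rfl
  rw [decide_eq_decide,
    SocketParity.sum_eq_count x (fun v => if hv : v < n then z ⟨v, hv⟩ else false) hz' p,
    ZMod.natCast_eq_one_iff_odd, Nat.odd_iff, SocketParity.count_split
      (fun μ => μ.all fun v => if hv : v < n then z ⟨v, hv⟩ else false) rfl
      (p.map (List.map Fin.val))]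

end Summit.PneNP.PneNP.Cruxes.PeaThreeNotInP.SocketBP
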